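import Summits.ValiantsHypothesis.ValiantsHypothesis.Theorems.SymPencilPerFourToricLowRank
import Summits.ValiantsHypothesis.ValiantsHypothesis.Theorems.SymPencilPerFourToricTwoRow

/-!
# Route `SymPencil` — the toric case at dimension `6`, VI: two rows with the same image and a
# `4`-dimensional complementary pair space (`--supports` stmt-ValiantsHypothesis-5674
# `SdcSuperquadratic`; crux workfile `Cruxes/SdcSuperquadratic/TORIC-SIX.md`, CASE 1, `dim J = 2`)

Setting: `W` a `6`-dimensional space of `4 × 4` matrices with H3, all row ranks `= 2`, all column
ranks `≤ 2`, and a pair space `X = W ∩ {rows q, q' = 0}` (rows `p, p'`) of dimension `4` — the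
sub-case `dim J = 2` of CASE 1 (`L_q = L_{q'}`) of the workfile, but the equality of the two row
images turns out not to be needed.

**Theorem** (`false_of_rows_eq_split`): impossible.  Rows `p, p'` split off as independent
single-row spaces; the pair space `Γ = W ∩ {rows p, p' = 0}` is `2`-dimensional of graph type.
If `L_p = L_{p'}`: the live columns of `L` and `L_p` are disjoint (a common live column has rank
`3`), so `L = K^{ab}`, `L_p = K^{cd}`, and H3 on `(E_{pc} + E_{p'd}, row q = e_a)` gives `1 = 0`.
If `L_p ≠ L_{p'}`: the pair lever on `Γ` has the `≥ 3`-dimensional kernel `L_p + L_{p'}`, so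
`Γ` is a transposed twisted pair (`SymPencilPerFourToricTwoRow.rows_eq_pair_of_graph`),
`L = K^{kl}`, and the lever on `X` with `e_k, e_l` makes `L_p ⊥ L_{p'}` off `{k,l}`, whence
`L_p = L_{p'} = K^{kl}` (`SymPencilPerFourToricLever`), a contradiction.

Honest framing: one sub-case of the toric case of `R6`; nothing here changes `sdc(per_4) ≥ 25`;
the crux `SdcSuperquadratic` and `VP ≠ VNP` are untouched.  No definitions, no named facts.
[folklore]
-/

noncomputable section

-- single-conjunct layout: Sub = Summit, duplicated namespace component intended
set_option linter.dupNamespace false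

namespace Summit.ValiantsHypothesis.ValiantsHypothesis.Theorems.SymPencilPerFourToricEqualSplit

open Matrix Finset Module
open Literature.Computability.AlgebraicComplexity
open Literature.Computability.AlgebraicComplexity.AlperBogartVelasco
open Summit.ValiantsHypothesis.ValiantsHypothesis.Theorems.SymPencilPerFourHessianRankThreeZero
open Summit.ValiantsHypothesis.ValiantsHypothesis.Theorems.SymPencilPerFourHessianToric
open Summit.ValiantsHypothesis.ValiantsHypothesis.Theorems.SymPencilPerFourToricLever
open Summit.ValiantsHypothesis.ValiantsHypothesis.Theorems.SymPencilPerFourToricZeroRow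
open Summit.ValiantsHypothesis.ValiantsHypothesis.Theorems.SymPencilPerFourToricLowRank
open Summit.ValiantsHypothesis.ValiantsHypothesis.Theorems.SymPencilPerFourToricTwoRow

variable {K : Type*} [Field K]

set_option maxHeartbeats 1600000 in
/-- **CASE 1, `dim J = 2`, of the toric case.**  See the module docstring. [folklore] -/
theorem false_of_rows_eq_split [CharZero K] (W : Submodule K (Fin 4 × Fin 4 → K))
    (hW3 : ∀ x ∈ W, ∀ (r c : Fin 3 → Fin 4), Function.Injective r → Function.Injective c →
      ((Matrix.of fun i j => x (i, j)).submatrix r c).permanent = 0)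
    (hcol : ∀ l : Fin 4, finrank K (W.map (LinearMap.funLeft K K fun i : Fin 4 => (i, l))) ≤ 2)
    (h6 : finrank K W = 6)
    (hn2 : ∀ r : Fin 4, finrank K (W.map (LinearMap.funLeft K K fun j : Fin 4 => (r, j))) = 2)
    (p p' q q' : Fin 4) (hpp' : p ≠ p') (hpq : p ≠ q) (hpq' : p ≠ q') (hp'q : p' ≠ q)
    (hp'q' : p' ≠ q') (hqq' : q ≠ q')
    (hX4 : finrank K ↥(W ⊓ LinearMap.ker (LinearMap.funLeft K K fun j : Fin 4 => (q, j)) ⊓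
      LinearMap.ker (LinearMap.funLeft K K fun j : Fin 4 => (q', j))) = 4) : False := by
  classical
  have hrow : ∀ r : Fin 4, finrank K (W.map (LinearMap.funLeft K K fun j : Fin 4 => (r, j))) ≤ 2 :=
    fun r => (hn2 r).le
  set ρp := (LinearMap.funLeft K K fun j : Fin 4 => (p, j)) with hρp
  set ρp' := (LinearMap.funLeft K K fun j : Fin 4 => (p', j)) with hρp'
  set ρq := (LinearMap.funLeft K K fun j : Fin 4 => (q, j)) with hρq
  set ρq' := (LinearMap.funLeft K K fun j : Fin 4 => (q', j)) with hρq'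
  have eρp : ∀ (x : Fin 4 × Fin 4 → K) (j : Fin 4), ρp x j = x (p, j) := fun _ _ => rfl
  have eρp' : ∀ (x : Fin 4 × Fin 4 → K) (j : Fin 4), ρp' x j = x (p', j) := fun _ _ => rfl
  have eρq : ∀ (x : Fin 4 × Fin 4 → K) (j : Fin 4), ρq x j = x (q, j) := fun _ _ => rfl
  have eρq' : ∀ (x : Fin 4 × Fin 4 → K) (j : Fin 4), ρq' x j = x (q', j) := fun _ _ => rfl
  have eγ : ∀ (l : Fin 4) (x : Fin 4 × Fin 4 → K) (i : Fin 4),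
      (LinearMap.funLeft K K fun i : Fin 4 => (i, l)) x i = x (i, l) := fun _ _ _ => rfl
  have hnp : finrank K (W.map ρp) = 2 := hn2 p
  have hnp' : finrank K (W.map ρp') = 2 := hn2 p'
  have hnq : finrank K (W.map ρq) = 2 := hn2 q
  have hnq'2 : finrank K (W.map ρq') = 2 := hn2 q'
  set X := W ⊓ LinearMap.ker ρq ⊓ LinearMap.ker ρq' with hXdef
  have memX : ∀ x, x ∈ X ↔ x ∈ W ∧ (∀ j, x (q, j) = 0) ∧ ∀ j, x (q', j) = 0 := fun x => by
    rw [hXdef]; exact mem_pair_iff W q q' x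
  -- rows `p, p'` split off
  have hXp' := finrank_eq_finrank_map_add_finrank_inf_ker X ρp'
  have hXp := finrank_eq_finrank_map_add_finrank_inf_ker X ρp
  have mXp' : finrank K (X.map ρp') ≤ 2 :=
    (Submodule.finrank_mono (Submodule.map_mono (inf_le_left.trans inf_le_left))).trans (hrow p')
  have mXp : finrank K (X.map ρp) ≤ 2 :=
    (Submodule.finrank_mono (Submodule.map_mono (inf_le_left.trans inf_le_left))).trans (hrow p)
  obtain ⟨-, Sp⟩ := single_row_realize W p q q' p' hpq hpq' hpp' hqq' hp'q.symm hp'q'.symm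
    (by change finrank K (W.map ρp) ≤ finrank K ↥(X ⊓ LinearMap.ker ρp'); omega)
  obtain ⟨-, Sp'⟩ := single_row_realize W p' q q' p hp'q hp'q' hpp'.symm hqq' hpq.symm hpq'.symm
    (by change finrank K (W.map ρp') ≤ finrank K ↥(X ⊓ LinearMap.ker ρp); omega)
  -- single-row elements with prescribed row value
  have Sp_val : ∀ v ∈ W.map ρp, ∃ z ∈ W, (∀ i j, i ≠ p → z (i, j) = 0) ∧ ∀ j, z (p, j) = v j := by
    rintro _ ⟨x, hx, rfl⟩
    obtain ⟨z, hz, hzs, hzr⟩ := Sp x hx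
    exact ⟨z, hz, hzs, fun j => by rw [hzr, eρp]⟩
  have Sp'_val : ∀ v ∈ W.map ρp', ∃ z ∈ W, (∀ i j, i ≠ p' → z (i, j) = 0) ∧ ∀ j, z (p', j) = v j := by
    rintro _ ⟨x, hx, rfl⟩
    obtain ⟨z, hz, hzs, hzr⟩ := Sp' x hx
    exact ⟨z, hz, hzs, fun j => by rw [hzr, eρp']⟩
  -- the pair space `Γ` of rows `q, q'`
  set Γ := W ⊓ LinearMap.ker ρp ⊓ LinearMap.ker ρp' with hΓdef
  have memΓ : ∀ x, x ∈ Γ ↔ x ∈ W ∧ (∀ j, x (p, j) = 0) ∧ ∀ j, x (p', j) = 0 := fun x => by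
    rw [hΓdef]; exact mem_pair_iff W p p' x
  -- every element of `W` reduces into `Γ` by single-row elements
  have hred : ∀ y ∈ W, ∃ γ ∈ Γ, (∀ j, γ (q, j) = y (q, j)) ∧ ∀ j, γ (q', j) = y (q', j) := by
    intro y hy
    obtain ⟨z, hz, hzs, hzr⟩ := Sp y hy
    obtain ⟨z', hz', hz's, hz'r⟩ := Sp' y hy
    refine ⟨y - z - z', (memΓ _).2 ⟨W.sub_mem (W.sub_mem hy hz) hz', fun j => ?_, fun j => ?_⟩,
      fun j => ?_, fun j => ?_⟩
    · simp [hzr, hz's p j hpp']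
    · simp [hzs p' j hpp'.symm, hz'r]
    · simp [hzs q j hpq.symm, hz's q j hp'q.symm]
    · simp [hzs q' j hpq'.symm, hz's q' j hp'q'.symm]
  have hΓq : Γ.map ρq = W.map ρq := by
    apply le_antisymm (Submodule.map_mono (inf_le_left.trans inf_le_left))
    rintro _ ⟨y, hy, rfl⟩
    obtain ⟨γ, hγ, hγq, -⟩ := hred y hy
    exact ⟨γ, hγ, funext fun j => by rw [eρq, eρq, hγq]⟩
  have hΓq' : Γ.map ρq' = W.map ρq' := by
    apply le_antisymm (Submodule.map_mono (inf_le_left.trans inf_le_left))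
    rintro _ ⟨y, hy, rfl⟩
    obtain ⟨γ, hγ, -, hγq'⟩ := hred y hy
    exact ⟨γ, hγ, funext fun j => by rw [eρq', eρq', hγq']⟩
  -- `dim Γ = 2`
  have hΓ2 : finrank K Γ = 2 := by
    have d : finrank K W ≤ finrank K Γ + finrank K (W.map ρp) + finrank K (W.map ρp') :=
      finrank_pair_le W p p'
    have d1 := finrank_eq_finrank_map_add_finrank_inf_ker W ρp
    have d2 := finrank_eq_finrank_map_add_finrank_inf_ker (W ⊓ LinearMap.ker ρp) ρp'
    have hfull : (W ⊓ LinearMap.ker ρp).map ρp' = W.map ρp' := by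
      apply le_antisymm (Submodule.map_mono inf_le_left)
      rintro _ ⟨x, hx, rfl⟩
      obtain ⟨z, hz, hzs, hzr⟩ := Sp' x hx
      refine ⟨z, Submodule.mem_inf.2 ⟨hz, ?_⟩, funext fun j => by rw [eρp', eρp', hzr]⟩
      rw [LinearMap.mem_ker]; funext j; rw [eρp]; exact hzs p j hpp'
    rw [hfull] at d2
    rw [← hΓdef] at d2
    omega
  -- graph type
  have hZ : ∀ x ∈ Γ, (∀ j, x (q, j) = 0) → x = 0 := by
    intro x hx hxq
    have h := finrank_eq_finrank_map_add_finrank_inf_ker Γ ρq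
    rw [hΓq, hnq, hΓ2] at h
    have h0 : finrank K ↥(Γ ⊓ LinearMap.ker ρq) = 0 := by omega
    rw [Submodule.finrank_eq_zero, Submodule.eq_bot_iff] at h0
    exact h0 x (Submodule.mem_inf.2 ⟨hx, by rw [LinearMap.mem_ker]; funext j; exact hxq j⟩)
  have hZ' : ∀ x ∈ Γ, (∀ j, x (q', j) = 0) → x = 0 := by
    intro x hx hxq
    have h := finrank_eq_finrank_map_add_finrank_inf_ker Γ ρq'
    rw [hΓq', hnq'2, hΓ2] at h
    have h0 : finrank K ↥(Γ ⊓ LinearMap.ker ρq') = 0 := by omega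
    rw [Submodule.finrank_eq_zero, Submodule.eq_bot_iff] at h0
    exact h0 x (Submodule.mem_inf.2 ⟨hx, by rw [LinearMap.mem_ker]; funext j; exact hxq j⟩)
  -- a live column for the three rows `p, p', q` has rank 3
  have hcol3 : ∀ j, (∃ x ∈ W, x (p, j) ≠ 0) → (∃ x ∈ W, x (p', j) ≠ 0) →
      (∃ y ∈ W, y (q, j) ≠ 0) → False := by
    rintro j ⟨x, hx, hxj⟩ ⟨x', hx', hx'j⟩ ⟨y, hy, hyj⟩
    obtain ⟨z, hz, hzs, hzr⟩ := Sp x hx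
    obtain ⟨z', hz', hz's, hz'r⟩ := Sp' x' hx'
    set γ := (LinearMap.funLeft K K fun i : Fin 4 => (i, j)) with hγ
    have eγ' : ∀ (x : Fin 4 × Fin 4 → K) (i : Fin 4), γ x i = x (i, j) := fun _ _ => rfl
    have hcj : finrank K (W.map γ) ≤ 2 := hcol j
    have hli : LinearIndependent K ![γ z, γ z', γ y] := by
      rw [Fintype.linearIndependent_iff]
      intro g hg i
      have hsum : g 0 • γ z + g 1 • γ z' + g 2 • γ y = 0 := by
        rw [Fin.sum_univ_three] at hg; simpa using hg
      have eq : (g 0 • γ z + g 1 • γ z' + g 2 • γ y) q = 0 := by rw [hsum]; rfl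
      have ep : (g 0 • γ z + g 1 • γ z' + g 2 • γ y) p = 0 := by rw [hsum]; rfl
      have ep' : (g 0 • γ z + g 1 • γ z' + g 2 • γ y) p' = 0 := by rw [hsum]; rfl
      simp only [Pi.add_apply, Pi.smul_apply, smul_eq_mul, eγ', hzs q j hpq.symm,
        hz's q j hp'q.symm, mul_zero, zero_add] at eq
      have g2 : g 2 = 0 := (mul_eq_zero.1 eq).resolve_right hyj
      simp only [Pi.add_apply, Pi.smul_apply, smul_eq_mul, eγ', hz's p j hpp', g2, mul_zero,
        add_zero, zero_mul, hzr] at ep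
      have g0 : g 0 = 0 := (mul_eq_zero.1 ep).resolve_right hxj
      simp only [Pi.add_apply, Pi.smul_apply, smul_eq_mul, eγ', hzs p' j hpp'.symm, g2, g0,
        mul_zero, add_zero, zero_mul, zero_add, hz'r] at ep'
      have g1 : g 1 = 0 := (mul_eq_zero.1 ep').resolve_right hx'j
      fin_cases i
      · exact g0
      · exact g1
      · exact g2
    have hle : Submodule.span K (Set.range ![γ z, γ z', γ y]) ≤ W.map γ := by
      rw [Submodule.span_le]
      rintro _ ⟨i, rfl⟩
      fin_cases i
      · exact ⟨z, hz, rfl⟩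
      · exact ⟨z', hz', rfl⟩
      · exact ⟨y, hy, rfl⟩
    have := Submodule.finrank_mono hle
    rw [finrank_span_eq_card hli, Fintype.card_fin] at this
    omega
  by_cases hLp : W.map ρp = W.map ρp'
  · ---- `L_p = L_{p'}`: disjoint live columns, then H3 gives `1 = 0`
    -- rows `p, p'` are dead wherever row `q` is live
    have dead_p : ∀ j, (∃ y ∈ W, y (q, j) ≠ 0) → ∀ x ∈ W, x (p, j) = 0 ∧ x (p', j) = 0 := by
      intro j hyj x hx
      by_contra hne
      rw [not_and_or] at hne
      rcases hne with h | h
      · -- `L_p` live at `j` ⇒ `L_{p'}` live at `j`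
        have : ρp x ∈ W.map ρp' := by rw [← hLp]; exact ⟨x, hx, rfl⟩
        obtain ⟨x', hx', hx'e⟩ := this
        have hx'j : x' (p', j) ≠ 0 := by rw [← eρp' x' j, hx'e, eρp]; exact h
        exact hcol3 j ⟨x, hx, h⟩ ⟨x', hx', hx'j⟩ hyj
      · have : ρp' x ∈ W.map ρp := by rw [hLp]; exact ⟨x, hx, rfl⟩
        obtain ⟨x', hx', hx'e⟩ := this
        have hx'j : x' (p, j) ≠ 0 := by rw [← eρp x' j, hx'e, eρp']; exact h
        exact hcol3 j ⟨x', hx', hx'j⟩ ⟨x, hx, h⟩ hyj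
    -- two live columns `a ≠ b` of row `q`
    obtain ⟨ya, hya, a, ha⟩ : ∃ y ∈ W, ∃ a, y (q, a) ≠ 0 := by
      by_contra h; push Not at h
      have : W.map ρq = ⊥ := by
        rw [Submodule.eq_bot_iff]; rintro _ ⟨y, hy, rfl⟩; funext j; rw [eρq]; exact h y hy j
      rw [this, finrank_bot] at hnq; exact absurd hnq (by norm_num)
    obtain ⟨yb, hyb, b, hab, hb⟩ : ∃ y ∈ W, ∃ b, a ≠ b ∧ y (q, b) ≠ 0 := by
      by_contra h; push Not at h
      have hle : W.map ρq ≤ K ∙ (Pi.single a (1 : K) : Fin 4 → K) := by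
        rintro _ ⟨y, hy, rfl⟩
        rw [Submodule.mem_span_singleton]
        refine ⟨y (q, a), funext fun j => ?_⟩
        rw [Pi.smul_apply, eρq, smul_eq_mul]
        by_cases hja : j = a
        · rw [hja, Pi.single_eq_same, mul_one]
        · rw [Pi.single_eq_of_ne hja, mul_zero, h y hy j (Ne.symm hja)]
      have := (Submodule.finrank_mono hle).trans (finrank_span_le_card ({(Pi.single a (1 : K) : Fin 4 → K)} : Set (Fin 4 → K)))
      simp at this; omega
    -- the other two columns `c, d`; `L_p ⊆ K^{cd}`, so `e_c, e_d ∈ L_p = L_{p'}`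
    obtain ⟨c, d, hcd, hca, hcb, hda, hdb, hcols⟩ := exists_other_two a b hab
    have hLp_cd : ∀ v ∈ W.map ρp, ∀ m, m ≠ c → m ≠ d → v m = 0 := by
      rintro _ ⟨x, hx, rfl⟩ m hmc hmd
      rw [eρp]
      rcases hcols m with hm | hm | hm | hm
      · rw [hm]; exact (dead_p a ⟨ya, hya, ha⟩ x hx).1
      · rw [hm]; exact (dead_p b ⟨yb, hyb, hb⟩ x hx).1
      · exact absurd hm hmc
      · exact absurd hm hmd
    have hec : (Pi.single c (1 : K) : Fin 4 → K) ∈ W.map ρp :=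
      mem_of_le_pair_of_finrank _ c d hLp_cd (by rw [hnp]) _
        (fun m hmc hmd => Pi.single_eq_of_ne hmc _)
    have hed : (Pi.single d (1 : K) : Fin 4 → K) ∈ W.map ρp' := by
      rw [← hLp]
      exact mem_of_le_pair_of_finrank _ c d hLp_cd (by rw [hnp]) _
        (fun m hmc hmd => Pi.single_eq_of_ne hmd _)
    obtain ⟨zc, hzc, hzcs, hzcr⟩ := Sp_val _ hec
    obtain ⟨zd, hzd, hzds, hzdr⟩ := Sp'_val _ hed
    -- row `q` is dead at `c` and `d` (they are live for `p`)
    have hqc : ya (q, c) = 0 := by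
      by_contra h
      have := (dead_p c ⟨ya, hya, h⟩ zc hzc).1
      rw [hzcr, Pi.single_eq_same] at this
      exact one_ne_zero this
    have hqd : ya (q, d) = 0 := by
      by_contra h
      have := (dead_p d ⟨ya, hya, h⟩ zd hzd).2
      rw [hzdr, Pi.single_eq_same] at this
      exact one_ne_zero this
    -- H3 via the pair lever on `zc + zd` against `ya`
    have e := pair_lever W hW3 (W.add_mem hzc hzd) hya hpp' hpq hp'q
      (fun j => by rw [Pi.add_apply, hzcs q j hpq.symm, hzds q j hp'q.symm, add_zero]) hca.symm hda.symm hcd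
    simp only [Pi.add_apply, hzcs p' _ hpp'.symm, hzds p _ hpp', add_zero, zero_add, hzcr, hzdr,
      Pi.single_eq_same, Pi.single_eq_of_ne hcd, Pi.single_eq_of_ne hcd.symm, hqc, hqd,
      mul_zero, mul_one, zero_mul, add_zero, zero_add, one_mul] at e
    exact ha e
  · ---- `L_p ≠ L_{p'}`: the lever on `Γ` has a `3`-dimensional kernel
    set M : Submodule K (Fin 4 → K) := W.map ρp ⊔ W.map ρp' with hM
    have hM3 : 3 ≤ finrank K M := by
      have h := Submodule.finrank_sup_add_finrank_inf_eq (W.map ρp) (W.map ρp')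
      rw [hnp, hnp'] at h
      have hinf : finrank K ↥(W.map ρp ⊓ W.map ρp') ≤ 1 := by
        by_contra hge
        push Not at hge
        have e1 : W.map ρp ⊓ W.map ρp' = W.map ρp :=
          Submodule.eq_of_le_of_finrank_le inf_le_left (by rw [hnp]; omega)
        have e2 : W.map ρp ⊓ W.map ρp' = W.map ρp' :=
          Submodule.eq_of_le_of_finrank_le inf_le_right (by rw [hnp']; omega)
        exact hLp (e1.symm.trans e2)
      rw [hM]; omega
    have hP : ∀ x ∈ Γ, ∀ l l' : Fin 4, l ≠ l' →
        x (q, l) * x (q', l') + x (q, l') * x (q', l) = 0 := by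
      intro x hx
      obtain ⟨hxW, hxp, hxp'⟩ := (memΓ x).1 hx
      refine perms_vanish_of_lever_three M hM3 x q q' fun u hu j₀ j₁ j₂ h01 h02 h12 => ?_
      rw [hM, Submodule.mem_sup] at hu
      obtain ⟨u₁, hu₁, u₂, hu₂, rfl⟩ := hu
      obtain ⟨y₁, hy₁, rfl⟩ := hu₁
      obtain ⟨y₂, hy₂, rfl⟩ := hu₂
      have e1 := pair_lever W hW3 hxW hy₁ hqq' hpq.symm hpq'.symm hxp h01 h02 h12
      have e2 := pair_lever W hW3 hxW hy₂ hqq' hp'q.symm hp'q'.symm hxp' h01 h02 h12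
      simp only [Pi.add_apply, eρp, eρp']
      linear_combination e1 + e2
    obtain ⟨k, l, hkl, hsupp, hontoq, -⟩ := rows_eq_pair_of_graph Γ q q' hP hZ hZ' hΓ2
    -- row `q` of `W` is dead off `{k, l}`, and realises `e_k, e_l` inside `Γ`
    have hqdead : ∀ y ∈ W, ∀ m, m ≠ k → m ≠ l → y (q, m) = 0 := by
      intro y hy m hmk hml
      obtain ⟨γ, hγ, hγq, -⟩ := hred y hy
      rw [← hγq]; exact (hsupp γ hγ m hmk hml).1
    obtain ⟨γk, hγk, hγkr⟩ := hontoq (Pi.single k 1) (fun m hmk hml => Pi.single_eq_of_ne hmk _)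
    obtain ⟨γl, hγl, hγlr⟩ := hontoq (Pi.single l 1) (fun m hmk hml => Pi.single_eq_of_ne hml _)
    have hγkW : γk ∈ W := ((memΓ γk).1 hγk).1
    have hγlW : γl ∈ W := ((memΓ γl).1 hγl).1
    -- lever on `X` with `e_k, e_l`: perms of rows `p, p'` off `{k, l}` vanish on `X`
    have hXperm : ∀ x ∈ X, ∀ m m' : Fin 4, m ≠ m' → ¬(m = k ∧ m' = l) → ¬(m = l ∧ m' = k) →
        x (p, m) * x (p', m') + x (p, m') * x (p', m) = 0 := by
      intro x hx
      obtain ⟨hxW, hxq, -⟩ := (memX x).1 hx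
      refine perms_vanish_of_lever_pair x p p' k l hkl fun u hu j₀ j₁ j₂ h01 h02 h12 => ?_
      rcases hu with hu | hu
      · have e := pair_lever W hW3 hxW hγkW hpp' hpq hp'q hxq h01 h02 h12
        rw [hγkr, hγkr, hγkr] at e; rw [hu]; exact e
      · have e := pair_lever W hW3 hxW hγlW hpp' hpq hp'q hxq h01 h02 h12
        rw [hγlr, hγlr, hγlr] at e; rw [hu]; exact e
    -- bilinear form: `L_p ⊥ L_{p'}` off `{k, l}`
    have hbil : ∀ v ∈ W.map ρp, ∀ v' ∈ W.map ρp', ∀ m m' : Fin 4, m ≠ m' →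
        ¬(m = k ∧ m' = l) → ¬(m = l ∧ m' = k) → v m * v' m' + v m' * v' m = 0 := by
      intro v hv v' hv' m m' hmm' h1 h2
      obtain ⟨z, hz, hzs, hzr⟩ := Sp_val v hv
      obtain ⟨z', hz', hz's, hz'r⟩ := Sp'_val v' hv'
      have hmem : z + z' ∈ X := (memX _).2 ⟨W.add_mem hz hz',
        fun j => by rw [Pi.add_apply, hzs q j hpq.symm, hz's q j hp'q.symm, add_zero],
        fun j => by rw [Pi.add_apply, hzs q' j hpq'.symm, hz's q' j hp'q'.symm, add_zero]⟩
      have e := hXperm _ hmem m m' hmm' h1 h2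
      simp only [Pi.add_apply, hzs p' _ hpp'.symm, hz's p _ hpp', add_zero, zero_add, hzr, hz'r] at e
      exact e
    have hLp_kl : ∀ v ∈ W.map ρp, ∀ m, m ≠ k → m ≠ l → v m = 0 :=
      subset_pair_of_bilinear_perm_orth _ _ k l hbil (by rw [hnp'])
    have hLp'_kl : ∀ v ∈ W.map ρp', ∀ m, m ≠ k → m ≠ l → v m = 0 :=
      subset_pair_of_bilinear_perm_orth _ _ k l
        (fun v hv v' hv' m m' hmm' h1 h2 => by
          have := hbil v' hv' v hv m m' hmm' h1 h2; linear_combination this) (by rw [hnp])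
    apply hLp
    apply le_antisymm
    · intro v hv
      exact mem_of_le_pair_of_finrank _ k l hLp'_kl (by rw [hnp']) v (hLp_kl v hv)
    · intro v hv
      exact mem_of_le_pair_of_finrank _ k l hLp_kl (by rw [hnp]) v (hLp'_kl v hv)

end Summit.ValiantsHypothesis.ValiantsHypothesis.Theorems.SymPencilPerFourToricEqualSplit

end
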